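import Summits.QuantumFields.YangMills.Theorems.BalabanUVNodesN15KingModelBoxOperator
import HarnessLib

/-!
# BalabanUVNodes ∕ N15 — THE KING-MODEL RUNG (PART Ϟ-a): THE COSINE (DCT-II) BASIS OF KING's REGION `Ω = Π_μ{0,…,n_μ−1}` —
# `w_k(s) = Π_μ cos(πk_μ(s_μ+½)∕n_μ)`, discrete orthogonality `Σ_s w_k(s)w_l(s) = δ_{kl}·Π_μ(n_μ ∕ 2^{[k_μ≠0]})`, invertibility of the cosine matrix, and
# «every matrix on `Ω` with all `w_k` as eigenvectors has `det = Π_k σ_k`, `tr = Σ_k σ_k`»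
# (Track A, DAG node N15 = NE2; FAN-OUT v1.1 §N15 s3 «KING-MODEL RUNG»; the linear algebra of the free-boundary operators of King p.670; count-neutral)

HONEST FRAMING.  Count-neutral (cell `pub-ymgap`, seat `pub-ymgap-dag-n15-e` g41; `--supports stmt-QuantumFields-27366 --as helper` = K3⁸).
TEMPLATE LITERATURE: C. King, Commun. Math. Phys. **102** (1986) 649–677 [King1986], §4 p.670 l.8–13: «By using multiple reflection representations, the propagators
`G^η_k` and `G^η_k(Ω)` can be written in terms of the operator defined by (2.13) with free boundary conditions (and `A = 0`, of course), as long as `Ω` is a rectangular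
parallelepiped which is a union of blocks of `L^k` sites.»  Parts Ν (g39) typed the free-boundary («Neumann») operators on `Ω = Π_μ{0,…,n_μ−1}` (`KingBox n`, `boxOp`, the
folding `foldOp` of reflection-symmetric operators of the doubled torus `Π ℤ∕2n_μ`); parts Ε-k∕Ε-n (g40) computed the TORUS determinants by the plane-wave basis.  The
free-boundary operators are diagonalised instead by the COSINE basis (the «DCT-II» family — folklore linear algebra of the Neumann Laplacian on a path): THIS FILE types that
basis on `KingBox n` and its orthogonality; part Ϟ-b proves that every folded reflection-symmetric operator is diagonal in it.
§1 (one dimension) `two_sin_half_mul_cos_halfInt` (`2sin(a∕2)cos(a(j+½)) = sin(a(j+1)) − sin(aj)`), `two_sin_half_mul_sum_cos_halfInt` (telescoping: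
`2sin(a∕2)Σ_{j<n}cos(a(j+½)) = sin(an)`), ★ `sum_cos_halfInt_eq_zero` (`Σ_{j<n} cos(πm(j+½)∕n) = 0` for integers `0 < |m| < 2n`), ★★ **`sum_cos_halfInt_mul_cos_halfInt`**
(DCT-II orthogonality: `Σ_{j<n} cos(πk(j+½)∕n)cos(πl(j+½)∕n) = δ_{kl}·(n if k = 0, n∕2 else)`, `k, l < n`).
§2 (the box) defs **`boxWave n k s = Π_μ cos(π k_μ (s_μ+½)∕n_μ)`** (`k, s ∈ KingBox n`), **`boxWaveWeight n k = Π_μ (n_μ if k_μ = 0, n_μ∕2 else)`**, **`boxWaveMatrix n (s,k) = boxWave n k s`**;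
`boxWaveWeight_pos`, ★★ **`sum_boxWave_mul_boxWave`** (`Σ_s w_k(s)w_l(s) = δ_{kl}·boxWaveWeight k` — Fubini over the coordinates + §1), ★ `boxWaveMatrix_transpose_mul_self`
(`WᵀW = diag(boxWaveWeight)`), ★ `det_boxWaveMatrix_ne_zero`, `boxWave_ne_zero`, `isUnit_det_boxWaveMatrix`.
§3 (generic spectral bookkeeping on `Ω`) ★★ **`mul_boxWaveMatrix_of_eigen`** (`B·W = W·diag σ`), ★★★ **`det_eq_prod_of_boxWave_eigen`** (all `w_k` eigenvectors with
eigenvalues `σ_k` ⇒ `det B = Π_k σ_k`), ★★ **`eq_conj_diagonal_of_boxWave_eigen`** (`B = W·diag σ·W⁻¹`), ★★ **`trace_eq_sum_of_boxWave_eigen`** (`tr B = Σ_k σ_k`),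
★ `eigen_unique_of_boxWave` (the eigenvalue at `w_k` is determined), `inv_mulVec_boxWave_of_eigen` (`B⁻¹w_k = σ_k⁻¹w_k` when all `σ ≠ 0`).

PRIOR TREE ART (named, USED not restated): part Ν-a `…KingModelBoxOperator` (`KingBox`); Mathlib (`Real.sin_sub_sin`, `Finset.sum_range_sub`, `Fintype.prod_sum`,
`Matrix.det_mul`).  NEAREST PRIOR ART for §1: `Literature/Analysis/Approximation/TrigonometricInterpolationEquidistant` (Zygmund X §2 (2.4): `sum_cos_node_eq_zero`,
`sum_cos_mul_cos_node_of_add_lt` — cosine orthogonality over the FULL circle of nodes `ξ₀ + 2πj∕N`); the HALF-range sums over the half-integer nodes `π(j+½)∕n`, `j < n`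
(the DCT-II grid) are not there and are proved here directly by telescoping.  NOT Bałaban's covariant objects; NOT a node discharge (N15 is booked through n15-a's knit,
untouched); nothing continuum-YM ∕ `ℝ⁴` ∕ OS ∕ Clay.  0 `sorry`; 3 `def`s (`boxWave`, `boxWaveWeight`, `boxWaveMatrix`).

HONEST SCOPE.  Finite-dimensional real linear algebra on `Ω = Π_μ Fin n_μ` (every `d`, all sides `n_μ ≥ 1`); no operator of King's is diagonalised in THIS file (that is
part Ϟ-b: `fold(A)·w_k = σ(k̂)·w_k`).  Locator: [King1986] §4 p.670 l.8–13 (free boundary conditions on `Ω`), (2.13) p.653.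
-/

noncomputable section

open scoped BigOperators
open Finset Matrix

namespace Summit.QuantumFields.YangMills.BalabanUVNodes.N15KingModelRung.TorusSpectral

variable {d : ℕ}

/-! ## §1 One dimension: cosine sums over the half-integer grid `π(j+½)∕n` -/

section OneDim

/-- `2 sin(a∕2)·cos(a(j+½)) = sin(a(j+1)) − sin(aj)`. [folklore] -/
theorem two_sin_half_mul_cos_halfInt (a : ℝ) (j : ℕ) :
    2 * Real.sin (a / 2) * Real.cos (a * (j + 1 / 2)) = Real.sin (a * (j + 1)) - Real.sin (a * j) := by
  rw [Real.sin_sub_sin]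
  congr 2 <;> ring

/-- TELESCOPING: `2 sin(a∕2)·Σ_{j<n} cos(a(j+½)) = sin(an)`. [folklore] -/
theorem two_sin_half_mul_sum_cos_halfInt (a : ℝ) (n : ℕ) :
    2 * Real.sin (a / 2) * ∑ j ∈ range n, Real.cos (a * (j + 1 / 2)) = Real.sin (a * n) := by
  rw [Finset.mul_sum]
  simp_rw [two_sin_half_mul_cos_halfInt]
  have h := Finset.sum_range_sub (fun j : ℕ => Real.sin (a * j)) n
  simp only [Nat.cast_add, Nat.cast_one] at h
  rw [h, Nat.cast_zero, mul_zero, Real.sin_zero, sub_zero]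

/-- ★ `Σ_{j<n} cos(πm(j+½)∕n) = 0` for every integer `m` with `0 < |m| < 2n` (the half-range cosine sum over the DCT-II grid; `sin(πm∕2n) ≠ 0` and `sin(πm) = 0`).
[folklore] -/
theorem sum_cos_halfInt_eq_zero {n : ℕ} (hn : 0 < n) {m : ℤ} (hm0 : m ≠ 0) (hm : |m| < 2 * n) :
    ∑ j ∈ range n, Real.cos (Real.pi * m * (j + 1 / 2) / n) = 0 := by
  have hnr : (0 : ℝ) < n := by exact_mod_cast hn
  set a : ℝ := Real.pi * m / n with ha
  have hterm : ∀ j : ℕ, Real.cos (Real.pi * m * (j + 1 / 2) / n) = Real.cos (a * (j + 1 / 2)) := fun j => by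
    rw [ha]; congr 1; field_simp
  simp_rw [hterm]
  have htel := two_sin_half_mul_sum_cos_halfInt a n
  have hsn : Real.sin (a * n) = 0 := by
    rw [ha, div_mul_cancel₀ _ hnr.ne', mul_comm]
    exact_mod_cast Real.sin_int_mul_pi m
  have hs2 : Real.sin (a / 2) ≠ 0 := by
    intro h0
    rw [Real.sin_eq_zero_iff] at h0
    obtain ⟨k, hk⟩ := h0
    rw [ha] at hk
    have hk' : (2 * n : ℝ) * k = m := by
      field_simp at hk
      have : (k : ℝ) * (n * 2) = m := by
        have hπ : Real.pi ≠ 0 := Real.pi_ne_zero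
        nlinarith [hk, hπ, mul_comm (k : ℝ) Real.pi]
      linarith
    have hkz : (2 * n : ℤ) * k = m := by exact_mod_cast hk'
    have hk0 : k ≠ 0 := by rintro rfl; simp at hkz; exact hm0 hkz.symm
    have : (2 * n : ℤ) ≤ |m| := by
      rw [← hkz, abs_mul, show |(2 * n : ℤ)| = 2 * n from abs_of_nonneg (by positivity)]
      exact le_mul_of_one_le_right (by positivity) (Int.one_le_abs hk0)
    omega
  rw [hsn] at htel
  rcases mul_eq_zero.mp htel with h | h
  · exact absurd (by simpa using h) hs2
  · exact h

/-- ★★ **DCT-II ORTHOGONALITY**: for `k, l < n`, `Σ_{j<n} cos(πk(j+½)∕n)·cos(πl(j+½)∕n)` is `0` for `k ≠ l`, `n∕2` for `k = l ≠ 0`, `n` for `k = l = 0`. [folklore] -/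
theorem sum_cos_halfInt_mul_cos_halfInt {n k l : ℕ} (hk : k < n) (hl : l < n) :
    ∑ j ∈ range n, Real.cos (Real.pi * k * (j + 1 / 2) / n) * Real.cos (Real.pi * l * (j + 1 / 2) / n)
      = if k = l then (if k = 0 then (n : ℝ) else (n : ℝ) / 2) else 0 := by
  have hn : 0 < n := by omega
  have hps : ∀ j : ℕ, Real.cos (Real.pi * k * (j + 1 / 2) / n) * Real.cos (Real.pi * l * (j + 1 / 2) / n) =
      (Real.cos (Real.pi * (((k : ℤ) - l : ℤ)) * (j + 1 / 2) / n) + Real.cos (Real.pi * (((k : ℤ) + l : ℤ)) * (j + 1 / 2) / n)) / 2 := by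
    intro j
    push_cast
    rw [show Real.pi * ((k : ℝ) - l) * (j + 1 / 2) / n = Real.pi * k * (j + 1 / 2) / n - Real.pi * l * (j + 1 / 2) / n by ring,
      show Real.pi * ((k : ℝ) + l) * (j + 1 / 2) / n = Real.pi * k * (j + 1 / 2) / n + Real.pi * l * (j + 1 / 2) / n by ring,
      Real.cos_sub, Real.cos_add]
    ring
  simp_rw [hps, ← Finset.sum_div, Finset.sum_add_distrib]
  have hminus : ∑ j ∈ range n, Real.cos (Real.pi * (((k : ℤ) - l : ℤ)) * (j + 1 / 2) / n) = if k = l then (n : ℝ) else 0 := by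
    split_ifs with h0
    · subst h0; simp
    · refine sum_cos_halfInt_eq_zero hn (by omega) ?_
      rw [abs_lt]; constructor <;> omega
  have hplus : ∑ j ∈ range n, Real.cos (Real.pi * (((k : ℤ) + l : ℤ)) * (j + 1 / 2) / n) = if k + l = 0 then (n : ℝ) else 0 := by
    split_ifs with h0
    · have hk0 : k = 0 := by omega
      have hl0 : l = 0 := by omega
      subst hk0; subst hl0; simp
    · refine sum_cos_halfInt_eq_zero hn (by omega) ?_
      rw [abs_of_nonneg (by positivity)]; omega
  rw [hminus, hplus]
  split_ifs <;> first | (exfalso; omega) | ring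

end OneDim

/-! ## §2 The cosine waves on King's region `Ω = Π_μ{0,…,n_μ−1}` -/

section Box

variable (n : Fin (d + 1) → ℕ) [hn : ∀ μ, NeZero (n μ)]

/-- THE COSINE (DCT-II ∕ NEUMANN) WAVE on `Ω` with box momentum `k ∈ Ω`: `w_k(s) = Π_μ cos(π k_μ (s_μ + ½) ∕ n_μ)` — the eigenfunctions of the free-boundary
(«Neumann») lattice Laplacian on the box (part Ϟ-b). [cite: King1986, §4 p.670, (2.13) p.653] -/
def boxWave (k : KingBox n) : KingBox n → ℝ := fun s => ∏ μ, Real.cos (Real.pi * (k μ).val * ((s μ).val + 1 / 2) / n μ)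

/-- the squared norm of `w_k`: `Π_μ (n_μ if k_μ = 0, n_μ∕2 otherwise)`. [folklore] -/
def boxWaveWeight (k : KingBox n) : ℝ := ∏ μ, if (k μ).val = 0 then (n μ : ℝ) else (n μ : ℝ) / 2

/-- THE COSINE MATRIX `W(s, k) = w_k(s)` (columns = the cosine waves). [folklore] -/
def boxWaveMatrix : Matrix (KingBox n) (KingBox n) ℝ := fun s k => boxWave n k s

omit hn in
/-- unfolding `w_k(s)`. [folklore] -/
theorem boxWave_apply (k s : KingBox n) : boxWave n k s = ∏ μ, Real.cos (Real.pi * (k μ).val * ((s μ).val + 1 / 2) / n μ) := rfl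

/-- `boxWaveWeight k > 0`. [folklore] -/
theorem boxWaveWeight_pos (k : KingBox n) : 0 < boxWaveWeight n k := by
  unfold boxWaveWeight
  refine Finset.prod_pos fun μ _ => ?_
  have : (0 : ℝ) < n μ := by exact_mod_cast NeZero.pos (n μ)
  split_ifs <;> positivity

omit hn in
/-- ★★ **DISCRETE ORTHOGONALITY OF THE COSINE WAVES ON `Ω`**: `Σ_{s∈Ω} w_k(s)·w_l(s) = δ_{kl}·boxWaveWeight k` (Fubini over the coordinates + the one-dimensional DCT-II
orthogonality). [folklore] -/
theorem sum_boxWave_mul_boxWave (k l : KingBox n) :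
    ∑ s : KingBox n, boxWave n k s * boxWave n l s = if k = l then boxWaveWeight n k else 0 := by
  have hcoord : ∀ μ : Fin (d + 1), ∑ j : Fin (n μ), Real.cos (Real.pi * (k μ).val * ((j : ℕ) + 1 / 2) / n μ) * Real.cos (Real.pi * (l μ).val * ((j : ℕ) + 1 / 2) / n μ)
      = if (k μ).val = (l μ).val then (if (k μ).val = 0 then (n μ : ℝ) else (n μ : ℝ) / 2) else 0 := by
    intro μ
    rw [Fin.sum_univ_eq_sum_range (fun j : ℕ => Real.cos (Real.pi * (k μ).val * ((j : ℕ) + 1 / 2) / n μ) * Real.cos (Real.pi * (l μ).val * ((j : ℕ) + 1 / 2) / n μ)) (n μ)]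
    exact sum_cos_halfInt_mul_cos_halfInt (k μ).isLt (l μ).isLt
  calc ∑ s : KingBox n, boxWave n k s * boxWave n l s
      = ∑ s : KingBox n, ∏ μ, Real.cos (Real.pi * (k μ).val * ((s μ).val + 1 / 2) / n μ) * Real.cos (Real.pi * (l μ).val * ((s μ).val + 1 / 2) / n μ) :=
        Finset.sum_congr rfl fun s _ => by rw [boxWave_apply, boxWave_apply, ← Finset.prod_mul_distrib]
    _ = ∏ μ, ∑ j : Fin (n μ), Real.cos (Real.pi * (k μ).val * ((j : ℕ) + 1 / 2) / n μ) * Real.cos (Real.pi * (l μ).val * ((j : ℕ) + 1 / 2) / n μ) :=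
        (Fintype.prod_sum (fun μ (j : Fin (n μ)) => Real.cos (Real.pi * (k μ).val * ((j : ℕ) + 1 / 2) / n μ) * Real.cos (Real.pi * (l μ).val * ((j : ℕ) + 1 / 2) / n μ))).symm
    _ = ∏ μ, (if (k μ).val = (l μ).val then (if (k μ).val = 0 then (n μ : ℝ) else (n μ : ℝ) / 2) else 0) := Finset.prod_congr rfl fun μ _ => hcoord μ
    _ = if k = l then boxWaveWeight n k else 0 := by
        split_ifs with hkl
        · subst hkl
          unfold boxWaveWeight
          exact Finset.prod_congr rfl fun μ _ => by rw [if_pos rfl]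
        · have : ∃ μ, (k μ).val ≠ (l μ).val := by
            by_contra h
            push Not at h
            exact hkl (funext fun μ => Fin.ext (h μ))
          obtain ⟨μ, hμ⟩ := this
          exact Finset.prod_eq_zero (Finset.mem_univ μ) (if_neg hμ)

omit hn in
/-- ★ `WᵀW = diag(boxWaveWeight)`. [folklore] -/
theorem boxWaveMatrix_transpose_mul_self : (boxWaveMatrix n)ᵀ * boxWaveMatrix n = Matrix.diagonal (boxWaveWeight n) := by
  ext k l
  rw [Matrix.mul_apply, Matrix.diagonal_apply]
  simp only [Matrix.transpose_apply, boxWaveMatrix]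
  exact sum_boxWave_mul_boxWave n k l

/-- ★ the cosine matrix is invertible: `det W ≠ 0` (`(det W)² = Π_k boxWaveWeight k > 0`). [folklore] -/
theorem det_boxWaveMatrix_ne_zero : (boxWaveMatrix n).det ≠ 0 := by
  intro h0
  have h := congrArg Matrix.det (boxWaveMatrix_transpose_mul_self n)
  rw [Matrix.det_mul, Matrix.det_transpose, h0, mul_zero, Matrix.det_diagonal] at h
  exact (Finset.prod_pos fun k _ => boxWaveWeight_pos n k).ne' h.symm

/-- `det W` is a unit. [folklore] -/
theorem isUnit_det_boxWaveMatrix : IsUnit (boxWaveMatrix n).det := (det_boxWaveMatrix_ne_zero n).isUnit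

/-- the cosine matrix is a unit of the matrix ring. [folklore] -/
theorem isUnit_boxWaveMatrix : IsUnit (boxWaveMatrix n) := (Matrix.isUnit_iff_isUnit_det _).mpr (isUnit_det_boxWaveMatrix n)

/-- `Σ_s w_k(s)² = boxWaveWeight k > 0`, so `w_k ≠ 0`. [folklore] -/
theorem boxWave_ne_zero (k : KingBox n) : boxWave n k ≠ 0 := by
  intro h0
  have h := sum_boxWave_mul_boxWave n k k
  rw [if_pos rfl, h0] at h
  simp only [Pi.zero_apply, mul_zero, Finset.sum_const_zero] at h
  exact (boxWaveWeight_pos n k).ne h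

end Box

/-! ## §3 Generic: an operator on `Ω` with the cosine waves as eigenvectors -/

section Eigen

variable (n : Fin (d + 1) → ℕ) [hn : ∀ μ, NeZero (n μ)]

omit hn in
/-- ★★ `B·W = W·diag σ` when every cosine wave is an eigenvector: `B w_k = σ_k w_k`. [folklore] -/
theorem mul_boxWaveMatrix_of_eigen (B : Matrix (KingBox n) (KingBox n) ℝ) (σ : KingBox n → ℝ) (hB : ∀ k, B *ᵥ boxWave n k = σ k • boxWave n k) :
    B * boxWaveMatrix n = boxWaveMatrix n * Matrix.diagonal σ := by
  ext s k
  rw [Matrix.mul_apply, Matrix.mul_diagonal]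
  have h := congrFun (hB k) s
  simp only [Matrix.mulVec, dotProduct, Pi.smul_apply, smul_eq_mul] at h
  simp only [boxWaveMatrix]
  rw [h, mul_comm]

/-- ★★★ **ALL COSINE WAVES EIGENVECTORS ⇒ `det B = Π_k σ_k`.** [folklore] -/
theorem det_eq_prod_of_boxWave_eigen (B : Matrix (KingBox n) (KingBox n) ℝ) (σ : KingBox n → ℝ) (hB : ∀ k, B *ᵥ boxWave n k = σ k • boxWave n k) :
    B.det = ∏ k : KingBox n, σ k := by
  have h := congrArg Matrix.det (mul_boxWaveMatrix_of_eigen n B σ hB)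
  rw [Matrix.det_mul, Matrix.det_mul, Matrix.det_diagonal, mul_comm] at h
  exact mul_left_cancel₀ (det_boxWaveMatrix_ne_zero n) h

/-- ★★ **DIAGONALISATION**: `B = W·diag σ·W⁻¹`. [folklore] -/
theorem eq_conj_diagonal_of_boxWave_eigen (B : Matrix (KingBox n) (KingBox n) ℝ) (σ : KingBox n → ℝ) (hB : ∀ k, B *ᵥ boxWave n k = σ k • boxWave n k) :
    B = boxWaveMatrix n * Matrix.diagonal σ * (boxWaveMatrix n)⁻¹ := by
  have h := mul_boxWaveMatrix_of_eigen n B σ hB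
  calc B = B * boxWaveMatrix n * (boxWaveMatrix n)⁻¹ := by rw [Matrix.mul_nonsing_inv_cancel_right _ _ (isUnit_det_boxWaveMatrix n)]
    _ = boxWaveMatrix n * Matrix.diagonal σ * (boxWaveMatrix n)⁻¹ := by rw [h]

/-- ★★ **`tr B = Σ_k σ_k`.** [folklore] -/
theorem trace_eq_sum_of_boxWave_eigen (B : Matrix (KingBox n) (KingBox n) ℝ) (σ : KingBox n → ℝ) (hB : ∀ k, B *ᵥ boxWave n k = σ k • boxWave n k) :
    B.trace = ∑ k : KingBox n, σ k := by
  rw [eq_conj_diagonal_of_boxWave_eigen n B σ hB, Matrix.mul_assoc, Matrix.trace_mul_comm, Matrix.mul_assoc,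
    Matrix.nonsing_inv_mul _ (isUnit_det_boxWaveMatrix n), Matrix.mul_one, Matrix.trace_diagonal]

/-- ★ the eigenvalue carried by `w_k` is unique (`w_k ≠ 0`). [folklore] -/
theorem eigen_unique_of_boxWave {B : Matrix (KingBox n) (KingBox n) ℝ} {k : KingBox n} {σ τ : ℝ}
    (hσ : B *ᵥ boxWave n k = σ • boxWave n k) (hτ : B *ᵥ boxWave n k = τ • boxWave n k) : σ = τ := by
  have h : (σ - τ) • boxWave n k = 0 := by rw [sub_smul, ← hσ, ← hτ, sub_self]
  rcases smul_eq_zero.mp h with h1 | h1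
  · exact sub_eq_zero.mp h1
  · exact absurd h1 (boxWave_ne_zero n k)

omit hn in
/-- powers: `B^j w_k = σ_k^j w_k`. [folklore] -/
theorem pow_mulVec_boxWave_of_eigen {B : Matrix (KingBox n) (KingBox n) ℝ} {k : KingBox n} {σ : ℝ} (hB : B *ᵥ boxWave n k = σ • boxWave n k) (j : ℕ) :
    (B ^ j) *ᵥ boxWave n k = σ ^ j • boxWave n k := by
  induction j with
  | zero => rw [pow_zero, pow_zero, Matrix.one_mulVec, one_smul]
  | succ j ih => rw [pow_succ, ← Matrix.mulVec_mulVec, hB, Matrix.mulVec_smul, ih, smul_smul, pow_succ, mul_comm]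

/-- inverse: if every `w_k` is an eigenvector with `σ_k ≠ 0` then `B⁻¹ w_k = σ_k⁻¹ w_k`. [folklore] -/
theorem inv_mulVec_boxWave_of_eigen (B : Matrix (KingBox n) (KingBox n) ℝ) (σ : KingBox n → ℝ) (hB : ∀ k, B *ᵥ boxWave n k = σ k • boxWave n k)
    (hσ : ∀ k, σ k ≠ 0) (k : KingBox n) : B⁻¹ *ᵥ boxWave n k = (σ k)⁻¹ • boxWave n k := by
  have hdet : IsUnit B.det := by
    rw [det_eq_prod_of_boxWave_eigen n B σ hB]
    exact (Finset.prod_ne_zero_iff.mpr fun k _ => hσ k).isUnit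
  have h1 : B⁻¹ *ᵥ (B *ᵥ boxWave n k) = boxWave n k := by rw [Matrix.mulVec_mulVec, Matrix.nonsing_inv_mul _ hdet, Matrix.one_mulVec]
  rw [hB k, Matrix.mulVec_smul] at h1
  calc B⁻¹ *ᵥ boxWave n k = (σ k)⁻¹ • (σ k • (B⁻¹ *ᵥ boxWave n k)) := by rw [smul_smul, inv_mul_cancel₀ (hσ k), one_smul]
    _ = (σ k)⁻¹ • boxWave n k := by rw [h1]

end Eigen

end Summit.QuantumFields.YangMills.BalabanUVNodes.N15KingModelRung.TorusSpectral

end
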